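import Mathlib
import Summits.CriticalPhenomena.CardyFormulaZ2.Theorems.CardyMagicRigidityDefs
import Summits.CriticalPhenomena.CardyFormulaZ2.Theorems.CardyMagicRigidityNestingRigiditySoftMachineMeasurable
import Literature.Probability.Percolation.SiteInterfaceStructure
import Literature.Probability.Percolation.LoopDensity
import Literature.Probability.Percolation.LoopRotationInvarianceProofs
import HarnessLib

/-!
# Soft machine, brick 7b: window-finiteness of the lattice loop representations at EVERY mesh (junk included)

Crux `Summit.CriticalPhenomena.CardyFormulaZ2.Theses.CardyMagicRigidity.NestingRigidity`
(stmt-CriticalPhenomena-4835), line `positive-cone-weight-doubling`, registered stub `stub_tamePrecompactness :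
TamePrecompact zEns ∧ TamePrecompact tEns`.  `TamePrecompact` (p130599) asks for measurable closeness events
`{(ω, s) | d_CN(E'.X δ ω, X s) ≤ ε}` for ALL real `δ` and `ε` and both lattice ensembles `E'`, junk meshes
`δ ≤ 0` included.  Brick 7 (`softMachine_measurableSet_isClose_latticeEnsembles`) covers `δ > 0`; its only
mesh-dependent input is WINDOW-FINITENESS of the lattice configuration (finitely many loops inside any disc).  This
file proves window-finiteness at every mesh and upgrades the anchor:

* `SoftMachine.windowFinite_siteLoopConfig` — at `δ ≠ 0` a loop of `siteLoopConfig δ ω` inside `B(0, R)` is THE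
  interface loop through its base face (`IsSiteInterfaceLoop.eq_of_base_eq`), a face with centre in
  `B̄(0, R/|δ|)` (finitely many); at `δ = 0` every loop is the constant loop at `0` (a polyline through zeros);
* `SoftMachine.windowFinite_bondLoopConfig` — at `δ > 0` this is `ncard_loops_meeting_le`; `δ < 0` is the
  rotation by `π` of `−δ > 0` (`bondLoopConfig (−δ) 0 = R_π (bondLoopConfig δ 0)`, `SoftMachine.bondLoopConfig_neg`,
  from `loopCurve δ π = loopCurve (−δ) 0` and `bondLoopConfig_add`), an isometry fixing `0`; at `δ = 0` every
  loop is constant;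
* `softMachine_measurableSet_isClose_latticeEnsembles_all` (registered anchor) — measurable closeness events at
  every mesh, for every `X` with measurable hitting events.
-/

noncomputable section

open MeasureTheory Set Filter Metric TopologicalSpace Function
open scoped Topology ENNReal NNReal Real

namespace Summit.CriticalPhenomena.CardyFormulaZ2.Cruxes.NestingRigidity.PositiveConeWeightDoubling

open Literature.Probability.RandomPlanarGeometry Literature.Probability.Percolation
  Literature.Probability.LatticeModels
open Summit.CriticalPhenomena.CardyFormulaZ2.Cruxes.NestingRigidity.RingCloudTomography

namespace SoftMachine

/-! ### Polylines through zeros -/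

/-- A nonempty polyline all of whose vertices are `0` is the constant map `0`. -/
theorem polyline_eq_const_of_forall_eq_zero {l : List ℂ} (hl : l ≠ []) (h : ∀ p ∈ l, p = 0) :
    Literature.Probability.LatticeModels.polyline l = ContinuousMap.const unitInterval (0 : ℂ) := by
  ext t
  have hsub := Literature.Probability.Percolation.range_polyline_subset_of_convex (convex_singleton (0 : ℂ)) hl
    (fun p hp ↦ mem_singleton_iff.2 (h p hp))
  exact mem_singleton_iff.1 (hsub (Set.mem_range_self t))

/-! ### Site-`𝕋` -/

/-- **Window-finiteness of `siteLoopConfig δ ω` at every mesh.** -/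
theorem windowFinite_siteLoopConfig (δ : ℝ) (ω : SiteConfig (Site 2)) (i : Fin 2) (R : ℝ) :
    {u ∈ (siteLoopConfig δ ω).F i | u.range ⊆ ball (0 : ℂ) R}.Finite := by
  classical
  rcases eq_or_ne δ 0 with rfl | hδ
  · -- `δ = 0`: every loop is the constant loop at `0`
    set c₀ : CurveClass ℂ := CurveClass.mk ⟨ContinuousMap.const unitInterval (0 : ℂ)⟩ with hc₀
    have hcurve : ∀ {f : HexVertex} (γ : hexGraph.Walk f f), siteLoopCurve 0 γ = c₀ := by
      intro f γ
      change CurveClass.mk ⟨γ.toCurve fun v ↦ ((0 : ℝ) : ℂ) * hexCenter v⟩ = c₀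
      rw [hc₀]
      congr 2
      change Literature.Probability.LatticeModels.polyline (γ.support.map fun v ↦ ((0 : ℝ) : ℂ) * hexCenter v) = _
      refine polyline_eq_const_of_forall_eq_zero (by simp) fun p hp ↦ ?_
      obtain ⟨v, -, rfl⟩ := List.mem_map.1 hp
      simp
    have hloop : c₀.IsLoop := by rw [← hcurve (SimpleGraph.Walk.nil : hexGraph.Walk (0, 0) (0, 0))]; exact isLoop_siteLoopCurve 0 _
    refine (Set.finite_singleton (UnbasedLoop.mk (BasedLoop.mk c₀ hloop))).subset ?_
    rintro u ⟨hu, -⟩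
    obtain ⟨v, γ, -, -, rfl⟩ := mem_siteLoopConfig_iff.1 hu
    rw [mem_singleton_iff]
    congr 1
    exact BasedLoop.mk_eq_mk.2 (hcurve γ)
  · -- `δ ≠ 0`: the loop through its base face, a face in a finite set
    have hδ' : 0 < |δ| := abs_pos.2 hδ
    let g : HexVertex → UnbasedLoop ℂ := fun F ↦
      if h : ∃ w : hexGraph.Walk F F, IsSiteInterfaceLoop ω w then
        UnbasedLoop.mk (BasedLoop.mk (siteLoopCurve δ h.choose) (isLoop_siteLoopCurve δ _))
      else UnbasedLoop.mk (BasedLoop.mk (siteLoopCurve δ (SimpleGraph.Walk.nil : hexGraph.Walk F F))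
        (isLoop_siteLoopCurve δ _))
    refine ((finite_setOf_norm_hexCenter_le one_pos (R / |δ|)).image g).subset ?_
    rintro u ⟨hu, hr⟩
    obtain ⟨f, γ, hγ, -, rfl⟩ := mem_siteLoopConfig_iff.1 hu
    refine ⟨f, ?_, ?_⟩
    · -- the base face lies in the finite set
      have hmem : (δ : ℂ) * hexCenter f ∈ ball (0 : ℂ) R := by
        refine hr ?_
        rw [range_mk_siteLoopCurve]
        exact SimpleGraph.Walk.mem_range_toCurve _ γ γ.start_mem_support
      rw [mem_ball_zero_iff, norm_mul, Complex.norm_real, Real.norm_eq_abs] at hmem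
      change ‖((1 : ℝ) : ℂ) * hexCenter f‖ ≤ R / |δ|
      rw [Complex.ofReal_one, one_mul, le_div_iff₀ hδ', mul_comm]
      exact hmem.le
    · have hex : ∃ w : hexGraph.Walk f f, IsSiteInterfaceLoop ω w := ⟨γ, hγ⟩
      change (if h : ∃ w : hexGraph.Walk f f, IsSiteInterfaceLoop ω w then
          UnbasedLoop.mk (BasedLoop.mk (siteLoopCurve δ h.choose) (isLoop_siteLoopCurve δ _))
        else UnbasedLoop.mk (BasedLoop.mk (siteLoopCurve δ (SimpleGraph.Walk.nil : hexGraph.Walk f f))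
          (isLoop_siteLoopCurve δ _))) = _
      rw [dif_pos hex]
      congr 1
      exact BasedLoop.mk_eq_mk.2 (by rw [hex.choose_spec.eq_of_base_eq hγ])

/-! ### Bond-`ℤ²` -/

/-- Midpoints scale linearly in the mesh: `medialPoint (−δ) e = − medialPoint δ e`. -/
theorem medialPoint_neg (δ : ℝ) (e : MedialVertex) : medialPoint (-δ) e = -medialPoint δ e := by
  induction e using Sym2.ind with
  | h x y =>
    simp only [medialPoint_mk, meshPoint, Complex.ofReal_neg]
    ring

/-- `medialPoint 0 e = 0`. -/
theorem medialPoint_zero (e : MedialVertex) : medialPoint 0 e = 0 := by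
  induction e using Sym2.ind with
  | h x y => simp [medialPoint_mk, meshPoint]

/-- Rotating by `π` is flipping the sign of the mesh: `loopCurve δ π = loopCurve (−δ) 0`. -/
theorem loopCurve_pi (δ : ℝ) : loopCurve δ π = loopCurve (-δ) 0 := by
  funext γ
  rw [loopCurve_eq_mk_polyline, loopCurve_eq_mk_polyline]
  congr 3
  refine List.map_congr_left fun e _ ↦ ?_
  rw [medialPoint_neg, Complex.exp_pi_mul_I, Complex.ofReal_zero, zero_mul, Complex.exp_zero]
  ring

/-- **Flipping the sign of the mesh rotates the loop representation by `π`.** -/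
theorem bondLoopConfig_neg (δ : ℝ) (ω : BondConfig (Site 2)) :
    bondLoopConfig (-δ) 0 ω = (bondLoopConfig δ 0 ω).map
      (Literature.Probability.RandomPlanarGeometry.toCM (rotation (Circle.exp π))) (rotation (Circle.exp π)).isometry := by
  have h := bondLoopConfig_add δ π 0 ω
  rw [add_zero] at h
  rw [← h]
  ext i u
  simp only [mem_bondLoopConfig_iff, loopCurve_pi]

/-- **Window-finiteness of `bondLoopConfig δ 0 ω` at every mesh.** -/
theorem windowFinite_bondLoopConfig (δ : ℝ) (ω : BondConfig (Site 2)) (i : Fin 2) (R : ℝ) :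
    {u ∈ (bondLoopConfig δ 0 ω).F i | u.range ⊆ ball (0 : ℂ) R}.Finite := by
  -- positive mesh
  have hpos : ∀ {δ : ℝ}, 0 < δ → ∀ (ω : BondConfig (Site 2)) (i : Fin 2) (R : ℝ),
      {u ∈ (bondLoopConfig δ 0 ω).F i | u.range ⊆ ball (0 : ℂ) R}.Finite := by
    intro δ hδ ω i R
    refine (ncard_loops_meeting_le hδ R ω).1.subset ?_
    rintro u ⟨hu, hr⟩
    refine ⟨?_, ?_⟩
    · fin_cases i
      · exact Or.inl hu
      · exact Or.inr hu
    · obtain ⟨x, hx⟩ := u.range_nonempty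
      exact ⟨x, hx, ball_subset_closedBall (hr hx)⟩
  rcases lt_trichotomy δ 0 with hδ | rfl | hδ
  · -- negative mesh: rotate the positive mesh `−δ` by `π`
    have hR : Isometry (Literature.Probability.RandomPlanarGeometry.toCM (rotation (Circle.exp π))) := (rotation (Circle.exp π)).isometry
    have heq : bondLoopConfig δ 0 ω = (bondLoopConfig (-δ) 0 ω).map
        (Literature.Probability.RandomPlanarGeometry.toCM (rotation (Circle.exp π))) hR := by
      rw [← bondLoopConfig_neg, neg_neg]
    rw [heq]
    refine ((hpos (neg_pos.2 hδ) ω i R).image (UnbasedLoop.map _ hR)).subset ?_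
    rintro u ⟨hu, hr⟩
    obtain ⟨v, hv, rfl⟩ := (LoopConfig.mem_map_iff hR).1 hu
    refine ⟨v, ⟨hv, fun x hx ↦ ?_⟩, rfl⟩
    rw [UnbasedLoop.range_map] at hr
    have := hr (mem_image_of_mem _ hx)
    rw [mem_ball_zero_iff] at this ⊢
    simpa using this
  · -- zero mesh: every loop is the constant loop at `0`
    set c₀ : CurveClass ℂ := CurveClass.mk ⟨ContinuousMap.const unitInterval (0 : ℂ)⟩ with hc₀
    have hcurve : ∀ {γ : List MedialVertex}, γ ≠ [] → loopCurve 0 0 γ = c₀ := by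
      intro γ hγ
      rw [loopCurve_zero, hc₀]
      congr 2
      refine polyline_eq_const_of_forall_eq_zero ?_ fun p hp ↦ ?_
      · simp [hγ]
      · obtain ⟨e, -, rfl⟩ := List.mem_map.1 hp
        exact medialPoint_zero e
    by_cases hex : ∃ γ : List MedialVertex, IsInterfaceLoop ω γ
    · obtain ⟨γ₀, hγ₀⟩ := hex
      have hloop : c₀.IsLoop := by rw [← hcurve hγ₀.ne_nil]; exact isLoop_loopCurve 0 0 hγ₀.ne_nil
      refine (Set.finite_singleton (UnbasedLoop.mk (BasedLoop.mk c₀ hloop))).subset ?_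
      rintro u ⟨hu, -⟩
      obtain ⟨γ, h, -, rfl⟩ := mem_bondLoopConfig_iff.1 hu
      rw [mem_singleton_iff]
      congr 1
      exact BasedLoop.mk_eq_mk.2 (hcurve h.ne_nil)
    · refine Set.finite_empty.subset ?_
      rintro u ⟨hu, -⟩
      obtain ⟨γ, h, -, rfl⟩ := mem_bondLoopConfig_iff.1 hu
      exact hex ⟨γ, h⟩
  · exact hpos hδ ω i R

end SoftMachine

/-- **Registered anchor** (`softMachine_measurableSet_isClose_latticeEnsembles_all`): for both lattice ensembles at
EVERY real mesh `δ` (junk `δ ≤ 0` included), every `ε`, and every random configuration `X` on a measurable space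
with measurable hitting events of closed sets of unbased loops, the closeness event
`{(ω, t) | d_CN(E'.X δ ω, X t) ≤ ε}` is measurable. -/
theorem softMachine_measurableSet_isClose_latticeEnsembles_all : ∀ E' ∈ latticeEnsembles, ∀ (δ ε : ℝ)
    (T : Type) [MeasurableSpace T] (X : T → LoopConfig ℂ),
    (∀ (i : Fin 2) (Q : Set (UnbasedLoop ℂ)), IsClosed Q → MeasurableSet {t | ∃ u ∈ (X t).F i, u ∈ Q}) →
    MeasurableSet {p : E'.Ω × T | LoopConfig.IsClose ε (E'.X δ p.1) (X p.2)} := by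
  intro E' hE' δ ε T _ X hX
  simp only [latticeEnsembles, Set.mem_insert_iff, Set.mem_singleton_iff] at hE'
  rcases hE' with rfl | rfl
  · exact SoftMachine.measurableSet_isClose_of_hit (ι := {γ : List MedialVertex // γ ≠ []})
      (fun ω ↦ bondLoopConfig δ 0 ω) X _ _
      (fun i k ↦ measurableSet_setOf_isInterfaceLoop_and k.1 i) (gen_bondLoopConfig δ 0)
      (fun ω i R ↦ SoftMachine.windowFinite_bondLoopConfig δ ω i R) hX ε
  · haveI := countable_sigma_hexLoop
    exact SoftMachine.measurableSet_isClose_of_hit (ι := Σ v : HexVertex, hexGraph.Walk v v)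
      (fun ω ↦ siteLoopConfig δ ω) X _ _
      (fun i k ↦ measurableSet_gen_siteLoopConfig i k) (gen_siteLoopConfig δ)
      (fun ω i R ↦ SoftMachine.windowFinite_siteLoopConfig δ ω i R) hX ε

end Summit.CriticalPhenomena.CardyFormulaZ2.Cruxes.NestingRigidity.PositiveConeWeightDoubling

end
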